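import Literature.Barriers.AtomisticToContinuum.OneDimensionalHardCoreRodsFinal
import Mathlib.MeasureTheory.Integral.Prod
import HarnessLib

/-!
# Hard rods: no one-particle mode holds more than `c₀(N)` particles (`λ_max ≤ c₀` for rods)

`Literature/Barriers/AtomisticToContinuum` (D-0021 barrier catalogue, conjunct
`BoseEinsteinCondensation`). Companion of `OneDimensionalHardCoreRods.lean` (the rod barrier
`OneDimensionalHardRods`: `c₀(N, N/ρ, a)/N → 0` for `ρa < 1/2`, proved in
`OneDimensionalHardCoreRodsFinal.lean`) and the rod analogue of `OneDimensionalHardCoreModes.lean`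
(ninth barrier audit of `OneDimensionalHardCore`, 2026-08-16).

The rod entry's caveat (c) ("`λ_max = c₀` is the untyped Fourier step") is typed here in the form
that the barrier uses: for EVERY mode `φ` with `|φ|²` integrable on `[0, L]`,

  `|⟨φ, γ^{rod}_N φ⟩| ≤ c₀^{rod}(N) ‖φ‖²`  (`norm_rodForm_le_rodZeroMomentumOccupation`),

with equality at the constant mode (`rodForm_const_one`), i.e. `λ_max(γ^{rod}_N) = c₀^{rod}(N)`;
hence, along the thermodynamic limit `L = N/ρ` at every fixed density `ρ < 1/(2a)`, the uniform
mode bound `|⟨φ, γ^{rod}_N φ⟩| ≤ εN‖φ‖²` for all large `N` (`eventually_norm_rodForm_le`), the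
negated `HasGroundStateBEC` shape uniformly over modes (`not_exists_linear_le_rodForm`), and the
negation of the literal one-dimensional periodic transport of the conjunct's quantifier shape
`∃ ρ₀ > 0, ∀ ρ < ρ₀, ∃ c > 0, ∀ᶠ N, ∃ φ, c N ‖φ‖² ≤ |⟨φ, γ_N φ⟩|` for rods of EVERY length `a ≥ 0`
(`not_exists_dilute_linear_le_rodForm`): the dilute-regime structure `∃ ρ₀ ∀ ρ < ρ₀` of the
conjunct does not rescue a mechanism that stays valid for one-dimensional hard rods.

The proof is the Schur test of the Modes companion, with continuity of the kernel replaced by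
measurability and boundedness: `ρ^{rod}_N ≥ 0` (`rodDensityMatrix_nonneg`), symmetry
`ρ_N(x, y) = ρ_N(y, x)`, and the row/column integrals `∫₀ᴸ ρ_N(x, y) dy = c₀(N)` for every
`x ∈ [0, L)` (translation invariance on the ring, `rodDensityMatrix_eq_shift` and rotation
invariance of Lebesgue measure, `measurePreserving_ringRotate`, of
`OneDimensionalHardCoreRodsShift.lean`).

## References

* [MazzantiEtAl2008] F. Mazzanti, G. E. Astrakharchik, J. Boronat, J. Casulleras, *Ground-state
  properties of a one-dimensional system of hard rods*, Phys. Rev. Lett. 100 (2008) 020401,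
  arXiv:0705.4377: p. 3 (one-body density matrix, translation invariance), p. 4 (momentum
  distribution `n(k)`; "a true BEC is suppressed").
* [ForresterEtAl2003] P. J. Forrester, N. E. Frankel, T. M. Garoni, N. S. Witte, Phys. Rev. A 67
  (2003) 043607, arXiv:cond-mat/0211126: §3.1 (on the circle the natural orbitals are the plane
  waves; occupations = momentum distribution).
* [DeiftItsKrasovsky2013] P. Deift, A. Its, I. Krasovsky, Comm. Pure Appl. Math. 66 (2013),
  arXiv:1207.4990: Remark 8 ("`λ^{(max)}_{N,L} = ρ^{(0)}_{N,L}`" for the impenetrable gas).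

## Design notes

One definition (`rodForm`, the quadratic form of the rod one-body density matrix, the rod copy of
`girardeauForm`) and no named fact; every result is a theorem about the objects of
`OneDimensionalHardCoreRods.lean`.
-/

noncomputable section

open MeasureTheory Filter Topology Finset Complex
open scoped BigOperators Real ComplexConjugate ENNReal

namespace Literature.Barriers.AtomisticToContinuum.BoseGas

variable {n : ℕ} {L a : ℝ}

/-! ### The quadratic form of the rod density matrix -/

/-- The quadratic form `⟨φ, γ^{rod}_N φ⟩ = ∫₀ᴸ∫₀ᴸ conj φ(x) ρ_N(x, y) φ(y) dy dx` of the one-body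
density matrix of the hard-rod ground state in the mode `φ` (for `‖φ‖ = 1` the expected
occupation of `φ`); the rod copy of `girardeauForm`. [cite: MazzantiEtAl2008, p. 3] -/
def rodForm (N : ℕ) (L a : ℝ) (φ : ℝ → ℂ) : ℂ :=
  ∫ x in Set.Icc 0 L, ∫ y in Set.Icc 0 L, conj (φ x) * (rodDensityMatrix N L a x y : ℂ) * φ y

/-- The rod density matrix is symmetric, `ρ_N(x, y) = ρ_N(y, x)` (real ground state). [folklore] -/
theorem rodDensityMatrix_comm (N : ℕ) (L a x y : ℝ) :
    rodDensityMatrix N L a x y = rodDensityMatrix N L a y x := by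
  cases N with
  | zero => rfl
  | succ n =>
    show (n + 1 : ℝ) * _ = (n + 1 : ℝ) * _
    congr 1
    exact integral_congr_ae (Eventually.of_forall fun X => mul_comm _ _)

/-- The rod density matrix is bounded (crude bound: bounded state, finite box). [folklore] -/
theorem exists_rodDensityMatrix_le (n : ℕ) (L a : ℝ) :
    ∃ K : ℝ, ∀ x y : ℝ, rodDensityMatrix (n + 1) L a x y ≤ K := by
  set box : Set (Fin n → ℝ) := Set.pi Set.univ (fun _ : Fin n => Set.Icc (0 : ℝ) L) with hbox
  have hvol : volume box < ⊤ := volume_pi_lt_top (by rw [Real.volume_Icc]; exact ENNReal.ofReal_lt_top)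
  -- a uniform bound on the rod state
  obtain ⟨B, hB0, hB⟩ : ∃ B : ℝ, 0 ≤ B ∧ ∀ z : Fin (n + 1) → ℝ, rodState (n + 1) L a z ≤ B :=
    ⟨_, (rodState_nonneg (n + 1) L a 0).trans (rodState_le (n + 1) L a 0),
      fun z => rodState_le (n + 1) L a z⟩
  refine ⟨(n + 1 : ℝ) * (B * B * (volume box).toReal), fun x y => ?_⟩
  have hdef : rodDensityMatrix (n + 1) L a x y = (n + 1 : ℝ) *
      ∫ X in box, rodState (n + 1) L a (Fin.snoc X x) * rodState (n + 1) L a (Fin.snoc X y) := rfl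
  rw [hdef]
  refine mul_le_mul_of_nonneg_left ?_ (by positivity)
  refine (le_abs_self _).trans ?_
  rw [← Real.norm_eq_abs]
  refine norm_setIntegral_le_of_norm_le_const hvol fun X _ => ?_
  rw [Real.norm_eq_abs, abs_of_nonneg (mul_nonneg (rodState_nonneg _ _ _ _) (rodState_nonneg _ _ _ _))]
  exact mul_le_mul (hB _) (hB _) (rodState_nonneg _ _ _ _) hB0

/-- The rod density matrix is jointly measurable in `(x, y)` (parametric integral of a measurable
integrand). [folklore] -/
theorem measurable_rodDensityMatrix_uncurry (n : ℕ) (L a : ℝ) :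
    Measurable (Function.uncurry (rodDensityMatrix (n + 1) L a)) := by
  have hdef : Function.uncurry (rodDensityMatrix (n + 1) L a) = fun p : ℝ × ℝ => (n + 1 : ℝ) *
      ∫ X in Set.pi Set.univ (fun _ : Fin n => Set.Icc (0 : ℝ) L),
        rodState (n + 1) L a (Fin.snoc X p.1) * rodState (n + 1) L a (Fin.snoc X p.2) := rfl
  rw [hdef]
  refine measurable_const.mul ?_
  have hF : StronglyMeasurable (Function.uncurry fun (p : ℝ × ℝ) (X : Fin n → ℝ) =>
      rodState (n + 1) L a (Fin.snoc X p.1) * rodState (n + 1) L a (Fin.snoc X p.2)) := by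
    refine Measurable.stronglyMeasurable ?_
    refine Measurable.mul ?_ ?_
    · exact (measurable_rodState (n + 1) L a).comp
        ((Continuous.finSnoc (A := fun _ : Fin (n + 1) => ℝ) continuous_fst
          continuous_snd).measurable.comp (measurable_snd.prodMk (measurable_fst.comp measurable_fst)))
    · exact (measurable_rodState (n + 1) L a).comp
        ((Continuous.finSnoc (A := fun _ : Fin (n + 1) => ℝ) continuous_fst
          continuous_snd).measurable.comp (measurable_snd.prodMk (measurable_snd.comp measurable_fst)))
  exact (hF.integral_prod_right'
    (ν := (volume : Measure (Fin n → ℝ)).restrict (Set.pi Set.univ fun _ => Set.Icc (0 : ℝ) L))).measurable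

/-! ### Row and column integrals -/

/-- **Row integrals**: `∫₀ᴸ ρ_N(x, y) dy = c₀(N)` for every `x ∈ [0, L)` (translation invariance
on the ring and rotation invariance of Lebesgue measure). [cite: MazzantiEtAl2008, p. 3] -/
theorem integral_rodDensityMatrix_row (hL : 0 < L) (a : ℝ) {x : ℝ} (hx : x ∈ Set.Ico 0 L) :
    ∫ y in Set.Icc 0 L, rodDensityMatrix (n + 1) L a x y = rodZeroMomentumOccupation (n + 1) L a := by
  rw [rodZeroMomentumOccupation_eq_integral_shift hL a]
  set g : ℝ → ℝ := fun s => rodDensityMatrix (n + 1) L a 0 s with hg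
  have hgm : Measurable g := measurable_rodDensityMatrix_zero n L a
  have hIco : (Set.Ico (0 : ℝ) L) =ᵐ[volume] Set.Icc 0 L := Ico_ae_eq_Icc
  rw [← setIntegral_congr_set hIco, ← setIntegral_congr_set hIco]
  have hpt : ∀ y ∈ Set.Ico (0 : ℝ) L,
      rodDensityMatrix (n + 1) L a x y = g (ringRotate hL (-x) y) := by
    intro y hy
    simp only [hg]
    rw [rodDensityMatrix_eq_shift hL a hx hy]
    unfold ringRotate
    rw [sub_eq_add_neg]
  rw [setIntegral_congr_fun measurableSet_Ico hpt]
  have hmp := measurePreserving_ringRotate hL (-x)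
  calc ∫ y in Set.Ico 0 L, g (ringRotate hL (-x) y)
      = ∫ y, g y ∂(Measure.map (ringRotate hL (-x)) (volume.restrict (Set.Ico 0 L))) :=
        (integral_map hmp.measurable.aemeasurable hgm.aestronglyMeasurable).symm
    _ = ∫ s in Set.Ico 0 L, g s := by rw [hmp.map_eq]

/-- **Column integrals**: `∫₀ᴸ ρ_N(x, y) dx = c₀(N)` for every `y ∈ [0, L)` (symmetry).
[cite: MazzantiEtAl2008, p. 3] -/
theorem integral_rodDensityMatrix_col (hL : 0 < L) (a : ℝ) {y : ℝ} (hy : y ∈ Set.Ico 0 L) :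
    ∫ x in Set.Icc 0 L, rodDensityMatrix (n + 1) L a x y = rodZeroMomentumOccupation (n + 1) L a := by
  rw [show (∫ x in Set.Icc 0 L, rodDensityMatrix (n + 1) L a x y) =
      ∫ x in Set.Icc 0 L, rodDensityMatrix (n + 1) L a y x from
    integral_congr_ae (Eventually.of_forall fun x => rodDensityMatrix_comm _ _ _ _ _)]
  exact integral_rodDensityMatrix_row hL a hy

/-- Almost every point of `[0, L]` lies in the chart `[0, L)`. [folklore] -/
theorem ae_restrict_Icc_mem_Ico (L : ℝ) :
    ∀ᵐ x ∂(volume.restrict (Set.Icc (0 : ℝ) L)), x ∈ Set.Ico (0 : ℝ) L := by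
  have hres : (volume : Measure ℝ).restrict (Set.Ico 0 L) = volume.restrict (Set.Icc 0 L) :=
    Measure.restrict_congr_set Ico_ae_eq_Icc
  rw [← hres]
  exact ae_restrict_mem measurableSet_Ico

/-! ### The Schur bound `λ_max ≤ c₀` for rods -/

/-- Integrability of `(x, y) ↦ ρ_N(x, y)|φ(y)|²` on `[0, L]²` (bounded measurable kernel times an
integrable function of `y`). [folklore] -/
theorem integrable_rodDensity_mul_normSq (n : ℕ) (L a : ℝ) (φ : ℝ → ℂ)
    (hφ : IntegrableOn (fun x => ‖φ x‖ ^ 2) (Set.Icc 0 L)) :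
    Integrable (fun p : ℝ × ℝ => rodDensityMatrix (n + 1) L a p.1 p.2 * ‖φ p.2‖ ^ 2)
      ((volume.restrict (Set.Icc (0 : ℝ) L)).prod (volume.restrict (Set.Icc (0 : ℝ) L))) := by
  set μ : Measure ℝ := volume.restrict (Set.Icc (0 : ℝ) L) with hμ
  obtain ⟨K, hK⟩ := exists_rodDensityMatrix_le n L a
  have hg : Integrable (fun p : ℝ × ℝ => K * ‖φ p.2‖ ^ 2) (μ.prod μ) := by
    have h1 : Integrable (fun y => K * ‖φ y‖ ^ 2) μ := hφ.const_mul _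
    exact h1.comp_snd μ
  refine hg.mono' ?_ ?_
  · exact ((measurable_rodDensityMatrix_uncurry n L a).aestronglyMeasurable).mul
      (hφ.aestronglyMeasurable.comp_snd)
  · refine Eventually.of_forall fun p => ?_
    rw [Real.norm_eq_abs, abs_mul, abs_of_nonneg (rodDensityMatrix_nonneg _ _ _ _ _),
      abs_of_nonneg (by positivity)]
    exact mul_le_mul_of_nonneg_right (hK p.1 p.2) (by positivity)

/-- Symmetric AM–GM for the rod kernel: `|φ(x)| ρ |φ(y)| ≤ ρ|φ(x)|²/2 + ρ|φ(y)|²/2` for `ρ ≥ 0`.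
[folklore] -/
theorem norm_rodIntegrand_le (N : ℕ) (L a : ℝ) (φ : ℝ → ℂ) (x y : ℝ) :
    ‖conj (φ x) * (rodDensityMatrix N L a x y : ℂ) * φ y‖ ≤
      rodDensityMatrix N L a x y * ‖φ x‖ ^ 2 / 2 + rodDensityMatrix N L a x y * ‖φ y‖ ^ 2 / 2 := by
  have hρ0 : 0 ≤ rodDensityMatrix N L a x y := rodDensityMatrix_nonneg _ _ _ _ _
  rw [norm_mul, norm_mul, Complex.norm_conj, Complex.norm_real, Real.norm_eq_abs, abs_of_nonneg hρ0]
  have h : ‖φ x‖ * ‖φ y‖ ≤ ‖φ x‖ ^ 2 / 2 + ‖φ y‖ ^ 2 / 2 := by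
    nlinarith [sq_nonneg (‖φ x‖ - ‖φ y‖)]
  calc ‖φ x‖ * rodDensityMatrix N L a x y * ‖φ y‖
      = rodDensityMatrix N L a x y * (‖φ x‖ * ‖φ y‖) := by ring
    _ ≤ rodDensityMatrix N L a x y * (‖φ x‖ ^ 2 / 2 + ‖φ y‖ ^ 2 / 2) :=
        mul_le_mul_of_nonneg_left h hρ0
    _ = _ := by ring

/-- **No mode holds more than `c₀(N)` rods: `λ_max(γ^{rod}_N) ≤ c₀^{rod}(N)`** (Schur test). For
every `L > 0`, every `N`, every rod length `a` and every mode `φ` with `|φ|²` integrable on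
`[0, L]`, `|⟨φ, γ^{rod}_N φ⟩| ≤ c₀(N) ‖φ‖²`; the constant mode attains the bound
(`rodForm_const_one`). On the ring the natural orbitals are the plane waves
[cite: ForresterEtAl2003, §3.1]; "`λ^{(max)}_{N,L} = ρ^{(0)}_{N,L}`"
[cite: DeiftItsKrasovsky2013, Remark 8]; for rods [cite: MazzantiEtAl2008, p. 3 and p. 4]. -/
theorem norm_rodForm_le_rodZeroMomentumOccupation (hL : 0 < L) (N : ℕ) (a : ℝ) (φ : ℝ → ℂ)
    (hφ : IntegrableOn (fun x => ‖φ x‖ ^ 2) (Set.Icc 0 L)) :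
    ‖rodForm N L a φ‖ ≤ rodZeroMomentumOccupation N L a * modeNormSq L φ := by
  cases N with
  | zero =>
    simp [rodForm, rodDensityMatrix, rodZeroMomentumOccupation]
  | succ n =>
    set c : ℝ := rodZeroMomentumOccupation (n + 1) L a with hc
    obtain ⟨K, hK⟩ := exists_rodDensityMatrix_le n L a
    have hvol : volume (Set.Icc (0 : ℝ) L) < ⊤ := by
      rw [Real.volume_Icc]; exact ENNReal.ofReal_lt_top
    have hae := ae_restrict_Icc_mem_Ico L
    have hρ0 : ∀ x y : ℝ, 0 ≤ rodDensityMatrix (n + 1) L a x y := fun x y =>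
      rodDensityMatrix_nonneg _ _ _ _ _
    -- measurability of the slices
    have hunc := measurable_rodDensityMatrix_uncurry n L a
    have hmeas_col : ∀ x : ℝ, Measurable (rodDensityMatrix (n + 1) L a x) := fun x =>
      hunc.of_uncurry_left
    -- integrability facts
    have hF := integrable_rodDensity_mul_normSq n L a φ hφ
    have hcol : ∀ x : ℝ, IntegrableOn (fun y => rodDensityMatrix (n + 1) L a x y * ‖φ y‖ ^ 2)
        (Set.Icc 0 L) := by
      intro x
      refine (hφ.const_mul K).mono' ((hmeas_col x).aestronglyMeasurable.mul hφ.aestronglyMeasurable)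
        (Eventually.of_forall fun y => ?_)
      rw [Real.norm_eq_abs, abs_mul, abs_of_nonneg (hρ0 x y), abs_of_nonneg (by positivity)]
      exact mul_le_mul_of_nonneg_right (hK x y) (by positivity)
    have hrow : ∀ x : ℝ, IntegrableOn (fun y => rodDensityMatrix (n + 1) L a x y * ‖φ x‖ ^ 2)
        (Set.Icc 0 L) := by
      intro x
      refine IntegrableOn.of_bound hvol ((hmeas_col x).mul_const _).aestronglyMeasurable
        (K * ‖φ x‖ ^ 2) (Eventually.of_forall fun y => ?_)
      rw [Real.norm_eq_abs, abs_mul, abs_of_nonneg (hρ0 x y), abs_of_nonneg (by positivity)]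
      exact mul_le_mul_of_nonneg_right (hK x y) (by positivity)
    -- inner bound, for every `x` in the chart
    have hinner : ∀ x ∈ Set.Ico (0 : ℝ) L,
        ‖∫ y in Set.Icc 0 L, conj (φ x) * (rodDensityMatrix (n + 1) L a x y : ℂ) * φ y‖ ≤
          c * ‖φ x‖ ^ 2 / 2 + (∫ y in Set.Icc 0 L, rodDensityMatrix (n + 1) L a x y * ‖φ y‖ ^ 2) / 2 := by
      intro x hx
      have hint : IntegrableOn (fun y => rodDensityMatrix (n + 1) L a x y * ‖φ x‖ ^ 2 / 2 +
          rodDensityMatrix (n + 1) L a x y * ‖φ y‖ ^ 2 / 2) (Set.Icc 0 L) :=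
        ((hrow x).div_const 2).add ((hcol x).div_const 2)
      calc ‖∫ y in Set.Icc 0 L, conj (φ x) * (rodDensityMatrix (n + 1) L a x y : ℂ) * φ y‖
          ≤ ∫ y in Set.Icc 0 L, ‖conj (φ x) * (rodDensityMatrix (n + 1) L a x y : ℂ) * φ y‖ :=
            norm_integral_le_integral_norm _
        _ ≤ ∫ y in Set.Icc 0 L, (rodDensityMatrix (n + 1) L a x y * ‖φ x‖ ^ 2 / 2 +
              rodDensityMatrix (n + 1) L a x y * ‖φ y‖ ^ 2 / 2) :=
            integral_mono_of_nonneg (Eventually.of_forall fun y => norm_nonneg _) hint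
              (Eventually.of_forall fun y => norm_rodIntegrand_le (n + 1) L a φ x y)
        _ = (∫ y in Set.Icc 0 L, rodDensityMatrix (n + 1) L a x y * ‖φ x‖ ^ 2 / 2) +
              ∫ y in Set.Icc 0 L, rodDensityMatrix (n + 1) L a x y * ‖φ y‖ ^ 2 / 2 :=
            integral_add ((hrow x).div_const 2) ((hcol x).div_const 2)
        _ = c * ‖φ x‖ ^ 2 / 2 +
              (∫ y in Set.Icc 0 L, rodDensityMatrix (n + 1) L a x y * ‖φ y‖ ^ 2) / 2 := by
            rw [integral_div, integral_div, integral_mul_const,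
              integral_rodDensityMatrix_row hL a hx]
    -- the column term, after Fubini
    have hswap : ∫ x in Set.Icc 0 L, ∫ y in Set.Icc 0 L,
        rodDensityMatrix (n + 1) L a x y * ‖φ y‖ ^ 2 = c * modeNormSq L φ := by
      rw [integral_integral_swap hF]
      have h2 : ∀ᵐ y : ℝ ∂(volume.restrict (Set.Icc (0 : ℝ) L)),
          ∫ x in Set.Icc 0 L, rodDensityMatrix (n + 1) L a x y * ‖φ y‖ ^ 2 = c * ‖φ y‖ ^ 2 := by
        filter_upwards [hae] with y hy
        rw [integral_mul_const, integral_rodDensityMatrix_col hL a hy]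
      rw [integral_congr_ae h2, integral_const_mul, modeNormSq]
    -- outer bound
    have hout1 : IntegrableOn (fun x => c * ‖φ x‖ ^ 2 / 2) (Set.Icc 0 L) :=
      (hφ.const_mul c).div_const 2
    have hout2 : IntegrableOn
        (fun x => (∫ y in Set.Icc 0 L, rodDensityMatrix (n + 1) L a x y * ‖φ y‖ ^ 2) / 2)
        (Set.Icc 0 L) := (hF.integral_prod_left).div_const 2
    have hout : IntegrableOn
        (fun x => c * ‖φ x‖ ^ 2 / 2 +
          (∫ y in Set.Icc 0 L, rodDensityMatrix (n + 1) L a x y * ‖φ y‖ ^ 2) / 2)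
        (Set.Icc 0 L) := hout1.add hout2
    have hinner_ae : ∀ᵐ x : ℝ ∂(volume.restrict (Set.Icc (0 : ℝ) L)),
        ‖∫ y in Set.Icc 0 L, conj (φ x) * (rodDensityMatrix (n + 1) L a x y : ℂ) * φ y‖ ≤
          c * ‖φ x‖ ^ 2 / 2 +
            (∫ y in Set.Icc 0 L, rodDensityMatrix (n + 1) L a x y * ‖φ y‖ ^ 2) / 2 := by
      filter_upwards [hae] with x hx using hinner x hx
    calc ‖rodForm (n + 1) L a φ‖
        ≤ ∫ x in Set.Icc 0 L,
            ‖∫ y in Set.Icc 0 L, conj (φ x) * (rodDensityMatrix (n + 1) L a x y : ℂ) * φ y‖ :=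
          norm_integral_le_integral_norm _
      _ ≤ ∫ x in Set.Icc 0 L, (c * ‖φ x‖ ^ 2 / 2 +
            (∫ y in Set.Icc 0 L, rodDensityMatrix (n + 1) L a x y * ‖φ y‖ ^ 2) / 2) :=
          integral_mono_of_nonneg (Eventually.of_forall fun x => norm_nonneg _) hout hinner_ae
      _ = (∫ x in Set.Icc 0 L, c * ‖φ x‖ ^ 2 / 2) +
            ∫ x in Set.Icc 0 L,
              (∫ y in Set.Icc 0 L, rodDensityMatrix (n + 1) L a x y * ‖φ y‖ ^ 2) / 2 :=
          integral_add hout1 hout2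
      _ = c * modeNormSq L φ / 2 + c * modeNormSq L φ / 2 := by
          rw [integral_div, integral_div, integral_const_mul, hswap, modeNormSq]
      _ = c * modeNormSq L φ := by ring

/-- **The constant mode attains the bound**: `⟨1, γ^{rod}_N 1⟩ = L c₀(N) = c₀(N)‖1‖²`, so
`λ_max(γ^{rod}_N) = c₀^{rod}(N)` exactly. [cite: MazzantiEtAl2008, p. 4] -/
theorem rodForm_const_one (hL : 0 < L) (N : ℕ) (a : ℝ) :
    rodForm N L a (fun _ => (1 : ℂ)) = ((L * rodZeroMomentumOccupation N L a : ℝ) : ℂ) := by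
  unfold rodForm rodZeroMomentumOccupation
  simp only [map_one, one_mul, mul_one, integral_complex_ofReal]
  rw [← mul_assoc, mul_inv_cancel₀ hL.ne', one_mul]

/-! ### Consequences along the thermodynamic limit `L = N/ρ`, `ρa < 1/2` -/

/-- **Uniform mode bound for rods**: for rods of length `a ≥ 0` at density `ρ > 0` with
`ρa < 1/2` and every `ε > 0`, for all large `N`, every mode `φ` with `|φ|²` integrable on
`[0, N/ρ]` has `|⟨φ, γ^{rod}_N φ⟩| ≤ ε N ‖φ‖²` — the largest eigenvalue of the rod one-body density
matrix is `o(N)` uniformly over modes (from `oneDimensionalHardRods_of_lt_half` and the Schur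
bound). [cite: MazzantiEtAl2008, p. 4] -/
theorem eventually_norm_rodForm_le (ha : 0 ≤ a) {ρ : ℝ} (hρ : 0 < ρ) (h : ρ * a < 1 / 2) {ε : ℝ}
    (hε : 0 < ε) :
    ∀ᶠ N : ℕ in atTop, ∀ φ : ℝ → ℂ, IntegrableOn (fun x => ‖φ x‖ ^ 2) (Set.Icc 0 (N / ρ)) →
      ‖rodForm N (N / ρ) a φ‖ ≤ ε * N * modeNormSq (N / ρ) φ := by
  have ht := oneDimensionalHardRods_of_lt_half a ha ρ hρ h
  have h1 : ∀ᶠ N : ℕ in atTop, rodZeroMomentumOccupation N (N / ρ) a / N < ε :=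
    ht.eventually (gt_mem_nhds hε)
  filter_upwards [h1, eventually_ge_atTop 1] with N hN hN1 φ hφ
  have hNpos : (0 : ℝ) < N := by exact_mod_cast hN1
  have hL : (0 : ℝ) < N / ρ := by positivity
  have hc : rodZeroMomentumOccupation N (N / ρ) a ≤ ε * N := by
    rw [div_lt_iff₀ hNpos] at hN
    exact hN.le
  calc ‖rodForm N (N / ρ) a φ‖
      ≤ rodZeroMomentumOccupation N (N / ρ) a * modeNormSq (N / ρ) φ :=
        norm_rodForm_le_rodZeroMomentumOccupation hL N a φ hφ
    _ ≤ ε * N * modeNormSq (N / ρ) φ :=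
        mul_le_mul_of_nonneg_right hc (modeNormSq_nonneg _ φ)

/-- **The transported `HasGroundStateBEC` shape fails for rods, uniformly over modes.** For rods
of length `a ≥ 0` at any fixed density `ρ < 1/(2a)`: for no `c > 0` does there eventually exist a
square-integrable mode `φ ≠ 0` on `[0, N/ρ]` with `c · N · ‖φ‖² ≤ |⟨φ, γ^{rod}_N φ⟩|`, i.e.
`λ_max(γ^{rod}_N) ≥ cN` fails along every tail of `N`. [cite: MazzantiEtAl2008, p. 4] -/
theorem not_exists_linear_le_rodForm (ha : 0 ≤ a) {ρ : ℝ} (hρ : 0 < ρ) (h : ρ * a < 1 / 2) :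
    ¬ ∃ c : ℝ, 0 < c ∧ ∀ᶠ N : ℕ in atTop, ∃ φ : ℝ → ℂ,
      IntegrableOn (fun x => ‖φ x‖ ^ 2) (Set.Icc 0 (N / ρ)) ∧ 0 < modeNormSq (N / ρ) φ ∧
        c * N * modeNormSq (N / ρ) φ ≤ ‖rodForm N (N / ρ) a φ‖ := by
  rintro ⟨c, hc, hN⟩
  have hev := eventually_norm_rodForm_le ha hρ h (half_pos hc)
  obtain ⟨N, ⟨φ, hφ, hpos, hle⟩, hb, hN1⟩ := (hN.and (hev.and (eventually_ge_atTop 1))).exists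
  have hb' := hb φ hφ
  have hNpos : (1 : ℝ) ≤ N := by exact_mod_cast hN1
  have : 0 < c * N * modeNormSq (N / ρ) φ := by positivity
  nlinarith

/-- **The dilute-regime quantifier shape of the conjunct does not help in one dimension.** For
rods of EVERY length `a ≥ 0` (in particular every `a > 0`, a genuine finite-range repulsive pair
interaction `v = ⊤·1_{[0,a]}`), the literal periodic one-dimensional transport of the shape of
`BoseEinsteinCondensation` — `∃ ρ₀ > 0, ∀ ρ ∈ (0, ρ₀), ∃ c > 0, ∀ᶠ N`, some mode on `[0, N/ρ]`
holds `≥ cN‖φ‖²` rods — is false: at each `ρ < min(ρ₀, 1/(2a))` separately the uniform mode bound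
applies, so neither a density threshold `ρ₀` nor `ρ`-dependent constants `c(ρ)`, `N₀(ρ)` rescue a
mechanism that remains valid for one-dimensional hard rods on the ring.
[cite: MazzantiEtAl2008, p. 3 and p. 4] -/
theorem not_exists_dilute_linear_le_rodForm (ha : 0 ≤ a) :
    ¬ ∃ ρ₀ : ℝ, 0 < ρ₀ ∧ ∀ ρ : ℝ, 0 < ρ → ρ < ρ₀ → ∃ c : ℝ, 0 < c ∧ ∀ᶠ N : ℕ in atTop,
      ∃ φ : ℝ → ℂ, IntegrableOn (fun x => ‖φ x‖ ^ 2) (Set.Icc 0 (N / ρ)) ∧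
        0 < modeNormSq (N / ρ) φ ∧ c * N * modeNormSq (N / ρ) φ ≤ ‖rodForm N (N / ρ) a φ‖ := by
  rintro ⟨ρ₀, hρ₀, H⟩
  set ρ : ℝ := min (ρ₀ / 2) (1 / (4 * a + 4)) with hρdef
  have ha4 : 0 < 4 * a + 4 := by positivity
  have hρpos : 0 < ρ := lt_min (half_pos hρ₀) (by positivity)
  have hρlt : ρ < ρ₀ := (min_le_left _ _).trans_lt (half_lt_self hρ₀)
  have hρa : ρ * a < 1 / 2 := by
    have h1 : ρ ≤ 1 / (4 * a + 4) := min_le_right _ _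
    have h2 : ρ * a ≤ 1 / (4 * a + 4) * a := mul_le_mul_of_nonneg_right h1 ha
    have h3 : 1 / (4 * a + 4) * a < 1 / 2 := by
      rw [div_mul_eq_mul_div, one_mul, div_lt_iff₀ ha4]
      linarith
    exact h2.trans_lt h3
  exact not_exists_linear_le_rodForm ha hρpos hρa (H ρ hρpos hρlt)

end Literature.Barriers.AtomisticToContinuum.BoseGas

end
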